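import Summits.Ventures.PercRepro.S1CoreCapSevenFinal
import Summits.Ventures.PercRepro.S1FiveCircuitBase
import Summits.Ventures.PercRepro.S2CapFree
import Summits.Ventures.PercRepro.S2DichotomyTools
import Summits.Ventures.PercRepro.S2FlatCountTwo
import Summits.Ventures.PercRepro.S2SpanningCount
import Summits.Ventures.PercRepro.S2TailCell
import Summits.Ventures.PercRepro.S2ThirteenSixSpreadNine
import Summits.Ventures.PercRepro.TriangleCapEightI

/-!
# PercRepro — S2: THE SCALED COLOOP-FREE CELL `(12, 6)` OF THE CELL `(13, 6)` AT `K₁ = 10219` MODULO THE SPREAD ROWS `t = 6, 7, 8`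
(p7, gen 15; sub-claim S2; the row `p = 13`)

The first coloop step of the cell `(13, 6)`: on `M ＼ {e}` (an `e`-free core of rank `12` on `18` points without coloops, caps
`10 / 36 / 162` — `caps_twelve_six_cf`) the weighted inequality `(Φ(13, 5) − 2)/2 · #U(12, 5) ≤ mid(12, 5)`. THE SPREAD CASE row by
row in `t ≤ 10`: the rows `t ≤ 5` by the sharp count of the top `5`-sets and the crude per-circuit charges of the top `6`-sets
(`455 t + 36·91 + 162·13 + 462`), the rows `t = 9, 10` by three pairwise disjoint triangles and the two three-set counts
(`H₅(3) = 6444`, `H₆(3) = 6237`); the spanning count `31180` (`t ≤ 2`) / `21313` (`t ≥ 3`); THE ROWS `t = 6, 7, 8` ARE THE HYPOTHESIS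
`hrows` (priced: `t = 6` at `0.97` by a disjoint pair and the per-triangle charges, `t = 7, 8` by the `M(K₄)` sub-case) —
**`c025_twelve_six_cfk1_spread_of_rows`**. THE CONCENTRATED CASES `ν = 5, 4` by the kit's nested dichotomy (`gencell6mod.py`,
`K₁ = 10219` with `(1742/63 − 2)/2 ≤ 2^17 / 10219`) — **`c025_twelve_six_cfk1_of_spread`**; together
**`ThmN.c025_twelve_six_cfk1_of_rows`**. Nothing about the cell `(13, 6)` or the window is claimed. Axioms: standard.
-/

open scoped Matroid

namespace PercRepro

namespace ThmN

open Set

variable {α : Type}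


/-- **The caps of the coloop-free scaled cell `(12, 6)`**: `s₃ ≤ 10`, `s₄ ≤ 36`, `s₅ ≤ 162` (the chains of `caps_fourteen_six_scaled_cf`
at `18` points). -/
theorem caps_twelve_six_cf (M : Matroid α) [M.Finite]
    (hd : M.E.encard = M.eRank + ((6 : ℕ) : ℕ∞)) (hn : M.E.ncard = 12 + 6)
    (hfree : ∀ e ∈ M.E, ∃ A ⊆ M.E \ {e}, e ∉ M.closure A ∧ e ∉ M.closure ((M.E \ {e}) \ A)) (hK : ∀ e, ¬ M.IsColoop e) :
    {C : Set α | M.IsCircuit C ∧ C.ncard = 3}.ncard ≤ 10 ∧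
      {C : Set α | M.IsCircuit C ∧ C.ncard = 4}.ncard ≤ 36 ∧
        {C : Set α | M.IsCircuit C ∧ C.ncard = 5}.ncard ≤ 162 := by
  have hs3 := TriangleCap.core_ncard_triangles_le_cq3 M hfree hd
  rw [show TriangleCap.cq3 6 = 10 by decide] at hs3
  have hcol : M.coloops = ∅ := S2.coloops_eq_empty_of_forall_not M hK
  have hm : 18 ≤ (M.E \ M.coloops).ncard := by
    rw [hcol, Set.sdiff_empty, hn]
  have hd' : M.E.encard = M.eRank + (((5 : ℕ) : ℕ∞) + 1) := by
    rw [hd]; norm_num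
  have h := S1.ncard_fourCircuits_sub_div_le_of_nonColoops M hfree hd' (by norm_num) hm (B := 28)
    (fun M' _ hfree' hd'' => by
      have h := ncard_fourCircuits_le_avgChain16 5 M' hfree' hd''
      rw [show avgChain16 5 = 28 by decide] at h
      exact h)
  have hs4 : {C : Set α | M.IsCircuit C ∧ C.ncard = 4}.ncard ≤ 36 := by
    have := S1.le_mul_div_of_sub_div_le (by norm_num : 4 < 18) h
    omega
  have hs5 := S2.ncard_fiveCircuits_le_of_no_coloop M hfree hd' hK (by omega)
  rw [hn] at hs5
  have h5 : (12 + 6) * S1.avgChain5b 5 / (12 + 6 - 5) = 162 := by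
    rw [show S1.avgChain5b 5 = 117 by decide]
  rw [h5] at hs5
  exact ⟨hs3, hs4, hs5⟩

/-- **The spread case of the scaled coloop-free cell `(12, 6)` at `K₁ = 10219`, the rows `t ≤ 5` and `t ≥ 9`** (the rows `t = 6, 7, 8`
the hypothesis `hrows`). -/
theorem c025_twelve_six_cfk1_spread_of_rows (M : Matroid α) [M.Finite]
    (hR : M.eRank = ((12 : ℕ) : ℕ∞)) (hn : M.E.ncard = 12 + 6)
    (hfree : ∀ e ∈ M.E, ∃ A ⊆ M.E \ {e}, e ∉ M.closure A ∧ e ∉ M.closure ((M.E \ {e}) \ A)) (hK : ∀ e, ¬ M.IsColoop e)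
    (h4 : ¬ ∃ W ⊆ M.E, W.ncard ≤ 9 ∧ W.encard = M.eRk W + 4)
    (hrows : ¬ (∃ W ⊆ M.E, W.ncard ≤ 9 ∧ W.encard = M.eRk W + 4) →
      6 ≤ {C : Set α | M.IsCircuit C ∧ C.ncard = 3}.ncard → {C : Set α | M.IsCircuit C ∧ C.ncard = 3}.ncard ≤ 8 →
      ((phiK 13 5 - 2) / 2) * (Matroid.topCount M 12 5 : ℚ) ≤ (Matroid.midCount M 12 5 : ℚ)) :
    ((phiK 13 5 - 2) / 2) * (Matroid.topCount M 12 5 : ℚ) ≤ (Matroid.midCount M 12 5 : ℚ) := by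
  classical
  have hd : M.E.encard = M.eRank + ((6 : ℕ) : ℕ∞) := by
    rw [hR, ← M.ground_finite.cast_ncard_eq, hn]
    push_cast
    ring
  obtain ⟨hs3, hs4, hs5⟩ := caps_twelve_six_cf M hd hn hfree hK
  have hflat : ∀ X ⊆ M.E, M.eRk X ≤ 5 → X.ncard ≤ 8 := fun X hX hr => by
    have := S2.ncard_le_of_eRk_le_of_not_nullity M 4 9 (by norm_num) h4 hX (r := 5) (by norm_num) (by exact_mod_cast hr)
    omega
  have hflat' : ∀ X ⊆ M.E, M.eRk X ≤ 4 → X.ncard ≤ 7 := fun X hX hr => by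
    have := S2.ncard_le_of_eRk_le_of_not_nullity M 4 9 (by norm_num) h4 hX (r := 4) (by norm_num) (by exact_mod_cast hr)
    omega
  have hEcard : M.ground_finite.toFinset.card = 12 + 6 := by
    rw [← Set.ncard_eq_toFinset_card _ M.ground_finite]; exact hn
  have hL0 : ∀ e ∈ M.E, ¬ M.IsLoop e := not_isLoop_of_free M hfree
  have hs : ∀ e ∈ M.E, ∀ f ∈ M.E, e ≠ f → M.eRk {e, f} = 2 := by
    intro e he f hf hef
    have h2 : (2 : ℕ∞) ≤ M.eRk {e, f} :=
      two_le_eRk_of_two_le_ncard_of_free M hfree (pair_subset he hf) (by rw [ncard_pair hef])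
    have h3 : M.eRk {e, f} ≤ 2 := by
      have := M.eRk_le_encard {e, f}
      rwa [encard_pair hef] at this
    exact le_antisymm h3 h2
  have hC1 : ∀ L ⊆ M.E, M.eRk L = 2 → L.ncard ≤ 3 :=
    fun L hL hr => ncard_le_three_of_eRk_two M hs hfree hL hr
  have hcirc : ∀ C, M.IsCircuit C → 3 ≤ C.encard := three_le_encard_of_circuit M hL0 hs
  have hTfin : {C : Set α | M.IsCircuit C ∧ C.ncard = 3}.Finite :=
    M.ground_finite.finite_subsets.subset (fun C hC => hC.1.subset_ground)
  have h9 : ∀ X ⊆ M.E, X.ncard ≤ 9 → X.encard ≤ M.eRk X + 3 := by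
    intro X hX hX9
    by_contra hlt
    push Not at hlt
    have hk : M.eRk X + 4 ≤ X.encard := by
      have := Order.add_one_le_of_lt hlt
      rwa [add_assoc, show (3 : ℕ∞) + 1 = 4 by norm_num] at this
    obtain ⟨W', hW'X, hW'⟩ := S2.exists_subset_encard_eq_eRk_add M hX 4 hk
    exact h4 ⟨W', hW'X.trans hX, (Set.ncard_le_ncard hW'X (M.ground_finite.subset hX)).trans hX9, hW'⟩
  have hs6 : {C : Set α | M.IsCircuit C ∧ C.ncard = 6}.ncard ≤ (6 + 5).choose 6 :=
    Matroid.ncard_circuits_le_choose_of_encard M hd 5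
  norm_num [Nat.choose] at hs6
  -- the cell inequality with `K₁ = 10219`
  have cellA : ∀ (U S m : ℕ) (A : ℚ), Matroid.topCount M 12 5 ≤ U →
      {X : Set α | X ⊆ M.E ∧ M.eRk X = M.eRank}.ncard ≤ S → m ≤ 1024 →
      1024 * (U : ℚ) ≤ ((1024 - m : ℕ) : ℚ) * 2 ^ (6 - 5) * (10219 : ℚ) →
      (1024 : ℚ) * (A + (S : ℚ)) ≤ (m : ℚ) * 2 ^ 18 →
      ({X : Set α | X ⊆ M.E ∧ M.eRk X ≤ 5}.ncard : ℚ) ≤ A →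
      ((phiK 13 5 - 2) / 2) * (Matroid.topCount M 12 5 : ℚ) ≤ (Matroid.midCount M 12 5 : ℚ) := by
    intro U S m A hU hS hm hpoly htail hA
    exact c025_core_five_cell_of_counts_xqictq5g M 12 6 (by norm_num) hR hn U hU _ hA S hS
      10219 (by norm_num) ((phiK 13 5 - 2) / 2) (by rw [phiK_thirteen_five]; norm_num) ⟨m, hm, hpoly, htail⟩
  -- the top count is the top `5`-sets plus the top `6`-sets
  have hU1 := S2.topCount_le_ncard_compl_spanning (M := M) hR hd 5
  simp only [Nat.cast_ofNat] at hU1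
  have hsplit : {B : Set α | B ⊆ M.E ∧ M.eRk B = 5 ∧ B.ncard ≤ 6 ∧ M.eRk (M.E \ B) = M.eRank}.ncard ≤
      {B : Set α | B ⊆ M.E ∧ B.ncard = 5 ∧ M.eRk B = 5 ∧ M.eRk (M.E \ B) = M.eRank}.ncard +
      {B : Set α | B ⊆ M.E ∧ B.ncard = 6 ∧ M.eRk B = 5 ∧ M.eRk (M.E \ B) = M.eRank}.ncard := by
    refine le_trans (Set.ncard_le_ncard ?_ ((M.ground_finite.finite_subsets.subset (fun B hB => hB.1)).union
      (M.ground_finite.finite_subsets.subset (fun B hB => hB.1)))) (Set.ncard_union_le _ _)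
    rintro B ⟨hBE, hB5, hB6, hBs⟩
    have hBfin : B.Finite := M.ground_finite.subset hBE
    have h5le : 5 ≤ B.ncard := by
      have := M.eRk_le_encard B
      rw [hB5, ← hBfin.cast_ncard_eq] at this
      exact_mod_cast this
    rcases (show B.ncard = 5 ∨ B.ncard = 6 by omega) with h | h
    · exact Or.inl ⟨hBE, h, hB5, hBs⟩
    · exact Or.inr ⟨hBE, h, hB5, hBs⟩
  have hUsum : Matroid.topCount M 12 5 ≤
      {B : Set α | B ⊆ M.E ∧ B.ncard = 5 ∧ M.eRk B = 5 ∧ M.eRk (M.E \ B) = M.eRank}.ncard +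
      {B : Set α | B ⊆ M.E ∧ B.ncard = 6 ∧ M.eRk B = 5 ∧ M.eRk (M.E \ B) = M.eRank}.ncard := hU1.trans hsplit
  -- the sharp count of the top `5`-sets (independent `5`-sets)
  have htop5 : {B : Set α | B ⊆ M.E ∧ B.ncard = 5 ∧ M.eRk B = 5 ∧ M.eRk (M.E \ B) = M.eRank}.ncard ≤
      {B : Set α | B ⊆ M.E ∧ B.ncard = 5 ∧ M.eRk B = 5}.ncard :=
    Set.ncard_le_ncard (fun B hB => ⟨hB.1, hB.2.1, hB.2.2.1⟩)
      (M.ground_finite.finite_subsets.subset (fun B hB => hB.1))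
  have hind5 := S2.ncard_indep_five_add_le (M := M) hC1
  rw [hn] at hind5
  norm_num [Nat.choose] at hind5
  -- the crude per-triangle charge `C(15, 3) = 455` of the top `6`-sets
  have hc364 : ∀ T : Set α, M.IsCircuit T → T.ncard = 3 →
      {B : Set α | B ⊆ M.E ∧ B.ncard = 6 ∧ T ⊆ B ∧ M.eRk (M.E \ B) = M.eRank}.ncard ≤ 455 := by
    intro T hT hT3
    have hsub : {B : Set α | B ⊆ M.E ∧ B.ncard = 6 ∧ T ⊆ B ∧ M.eRk (M.E \ B) = M.eRank} ⊆
        {X : Set α | X ⊆ M.E ∧ X.ncard = 6 ∧ T ⊆ X} := fun B hB => ⟨hB.1, hB.2.1, hB.2.2.1⟩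
    have h := (Set.ncard_le_ncard hsub (M.ground_finite.finite_subsets.subset (fun X hX => hX.1))).trans
      (S2.ncard_subsets_superset_le M hT.subset_ground 6)
    rw [hn, hT3] at h
    norm_num [Nat.choose] at h
    exact h
  have htop6 := S2.ncard_top_six_le M hn hcirc 455 hc364
  norm_num [Nat.choose] at htop6
  -- the spanning counts
  have hSkit : {X : Set α | X ⊆ M.E ∧ M.eRk X = M.eRank}.ncard ≤ 31180 := by
    have hS := Matroid.ncard_spanning_le (M := M) hd
    rw [hEcard] at hS
    exact hS.trans (by decide)
  have hspan3 : 3 ≤ {C : Set α | M.IsCircuit C ∧ C.ncard = 3}.ncard →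
      {X : Set α | X ⊆ M.E ∧ M.eRk X = M.eRank}.ncard ≤ 21313 := by
    intro h3
    obtain ⟨T₁, T₂, T₃, hT₁, hT₂, hT₃, h12, h13, h23⟩ := (Set.two_lt_ncard_iff hTfin).1 (by omega)
    have hS := S2.ncard_spanning_add_le_of_three_triangles M hR hn (by norm_num) hC1 hT₁.1 hT₁.2 hT₂.1 hT₂.2 hT₃.1 hT₃.2 h12 h13 h23
    norm_num [Finset.sum_range_succ, Nat.choose] at hS
    omega
  -- the rows `t ≥ 9`: three pairwise disjoint triangles
  have hnine : 9 ≤ {C : Set α | M.IsCircuit C ∧ C.ncard = 3}.ncard → Matroid.topCount M 12 5 ≤ 12681 := by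
    intro ht9
    obtain ⟨T₁, T₂, T₃, hT₁, hT₁3, hT₂, hT₂3, hT₃, hT₃3, d12, d13, d23⟩ :=
      S2.exists_three_pairwise_disjoint_triangles_of_nine M hC1 h9 ht9
    have hfinT : ∀ {T : Set α}, M.IsCircuit T → T.Finite := fun hT => M.ground_finite.subset hT.subset_ground
    have hne_of_disj : ∀ {T T' : Set α}, T.ncard = 3 → Disjoint T T' → T ≠ T' := by
      intro T T' hT3 hdis heq
      subst heq
      have hemp : T = ∅ := by
        rw [← Set.inter_self T]
        exact Set.disjoint_iff_inter_eq_empty.1 hdis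
      rw [hemp, Set.ncard_empty] at hT3
      omega
    have n12 : T₁ ≠ T₂ := hne_of_disj hT₁3 d12
    have n13 : T₁ ≠ T₃ := hne_of_disj hT₁3 d13
    have n23 : T₂ ≠ T₃ := hne_of_disj hT₂3 d23
    have hsize2 : ∀ {T T' : Set α}, M.IsCircuit T → T.ncard = 3 → M.IsCircuit T' → T'.ncard = 3 → Disjoint T T' →
        (M.E \ (T ∪ T')).ncard = 12 := by
      intro T T' hT hT3 hT' hT'3 hdis
      have hsub : T ∪ T' ⊆ M.E := Set.union_subset hT.subset_ground hT'.subset_ground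
      have h := Set.ncard_sdiff_add_ncard_of_subset hsub M.ground_finite
      have hu := Set.ncard_union_eq hdis (hfinT hT) (hfinT hT')
      omega
    have hsize3 : (M.E \ (T₁ ∪ T₂ ∪ T₃)).ncard = 9 := by
      have hsub : T₁ ∪ T₂ ∪ T₃ ⊆ M.E :=
        Set.union_subset (Set.union_subset hT₁.subset_ground hT₂.subset_ground) hT₃.subset_ground
      have h := Set.ncard_sdiff_add_ncard_of_subset hsub M.ground_finite
      have hu12 := Set.ncard_union_eq d12 (hfinT hT₁) (hfinT hT₂)
      have hu : (T₁ ∪ T₂ ∪ T₃).ncard = (T₁ ∪ T₂).ncard + T₃.ncard :=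
        Set.ncard_union_eq (Set.disjoint_union_left.2 ⟨d13, d23⟩) ((hfinT hT₁).union (hfinT hT₂)) (hfinT hT₃)
      omega
    have hsize1 : ∀ {T : Set α}, M.IsCircuit T → T.ncard = 3 → (M.E \ T).ncard = 15 := by
      intro T hT hT3
      have h := Set.ncard_sdiff_add_ncard_of_subset hT.subset_ground M.ground_finite
      omega
    have htop5' : {B : Set α | B ⊆ M.E ∧ B.ncard = 5 ∧ M.eRk B = 5 ∧ M.eRk (M.E \ B) = M.eRank}.ncard ≤ 6444 := by
      have hhit12 := S2.top_five_inter_union_nonempty M hR hn hT₁ hT₂ n12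
      have hhit13 := S2.top_five_inter_union_nonempty M hR hn hT₁ hT₃ n13
      have hhit23 := S2.top_five_inter_union_nonempty M hR hn hT₂ hT₃ n23
      have hsub : {B : Set α | B ⊆ M.E ∧ B.ncard = 5 ∧ M.eRk B = 5 ∧ M.eRk (M.E \ B) = M.eRank} ⊆
          {X : Set α | X ⊆ M.E ∧ X.ncard = 5 ∧
            (((X ∩ T₁).Nonempty ∧ (X ∩ T₂).Nonempty) ∨ ((X ∩ T₁).Nonempty ∧ (X ∩ T₃).Nonempty) ∨
              ((X ∩ T₂).Nonempty ∧ (X ∩ T₃).Nonempty))} := by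
        rintro B ⟨hBE, hB5, -, hBs⟩
        exact ⟨hBE, hB5, two_of_three_of_pair_unions (hhit12 B hBE hB5 hBs) (hhit13 B hBE hB5 hBs) (hhit23 B hBE hB5 hBs)⟩
      have hle := Set.ncard_le_ncard hsub (M.ground_finite.finite_subsets.subset (fun X hX => hX.1))
      have hcount := S2.ncard_subsets_two_of_three_add_le M.E T₁ T₂ T₃ M.ground_finite 5
      rw [hn, hsize2 hT₁ hT₁3 hT₂ hT₂3 d12, hsize2 hT₁ hT₁3 hT₃ hT₃3 d13, hsize2 hT₂ hT₂3 hT₃ hT₃3 d23, hsize3] at hcount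
      norm_num [Nat.choose] at hcount
      omega
    have htop6' : {B : Set α | B ⊆ M.E ∧ B.ncard = 6 ∧ M.eRk B = 5 ∧ M.eRk (M.E \ B) = M.eRank}.ncard ≤ 6237 := by
      have hmeet : ∀ B ⊆ M.E, B.ncard = 6 → M.eRk (M.E \ B) = M.eRank → ∀ {C : Set α}, M.IsCircuit C → (B ∩ C).Nonempty := by
        intro B hBE hB6 hBs C hC
        by_contra hemp
        rw [Set.not_nonempty_iff_eq_empty, ← Set.disjoint_iff_inter_eq_empty] at hemp
        have hCsub : C ⊆ M.E \ B := Set.subset_sdiff.2 ⟨hC.subset_ground, hemp.symm⟩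
        have hfinEB : (M.E \ B).Finite := M.ground_finite.subset sdiff_subset
        have hcard : (M.E \ B).ncard = 12 := by
          have h := Set.ncard_sdiff_add_ncard_of_subset hBE M.ground_finite
          omega
        have hind : M.Indep (M.E \ B) := by
          rw [Matroid.indep_iff_eRk_eq_encard_of_finite hfinEB, hBs, hR, ← hfinEB.cast_ncard_eq, hcard]
        exact hC.dep.not_indep (hind.subset hCsub)
      have hsub : {B : Set α | B ⊆ M.E ∧ B.ncard = 6 ∧ M.eRk B = 5 ∧ M.eRk (M.E \ B) = M.eRank} ⊆
          {X : Set α | X ⊆ M.E ∧ X.ncard = 6 ∧ (X ∩ T₁).Nonempty ∧ (X ∩ T₂).Nonempty ∧ (X ∩ T₃).Nonempty} := by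
        rintro B ⟨hBE, hB6, -, hBs⟩
        exact ⟨hBE, hB6, hmeet B hBE hB6 hBs hT₁, hmeet B hBE hB6 hBs hT₂, hmeet B hBE hB6 hBs hT₃⟩
      have hle := Set.ncard_le_ncard hsub (M.ground_finite.finite_subsets.subset (fun X hX => hX.1))
      have hcount := S2.ncard_subsets_inter_nonempty_three_add_le M.E T₁ T₂ T₃ M.ground_finite 6
      rw [hn, hsize1 hT₁ hT₁3, hsize1 hT₂ hT₂3, hsize1 hT₃ hT₃3, hsize2 hT₁ hT₁3 hT₂ hT₂3 d12,
        hsize2 hT₁ hT₁3 hT₃ hT₃3 d13, hsize2 hT₂ hT₂3 hT₃ hT₃3 d23, hsize3] at hcount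
      norm_num [Nat.choose] at hcount
      omega
    omega
  -- the exact triangle count `t` and the rank part of the tail at `t`
  obtain ⟨t, ht⟩ : ∃ t, {C : Set α | M.IsCircuit C ∧ C.ncard = 3}.ncard = t := ⟨_, rfl⟩
  have hA := ncard_eRk_le_five_le_spread M 12 6 (by norm_num) hR hn hfree hflat hflat' t 36 162 ht.le hs4 hs5
  rw [ht] at hs3 hspan3 hnine hind5 htop6
  rw [ht] at hrows
  -- `t ≤ 5`: the sharp count and the crude charges; `t = 6, 7, 8`: the hypothesis; `t ≥ 9`: three disjoint triangles
  have hU5 : t ≤ 5 → Matroid.topCount M 12 5 ≤ 8568 - 105 * t + t.choose 2 + 455 * t + 5844 := by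
    intro ht5
    have hch : t.choose 2 ≤ 10 := by
      interval_cases t <;> decide
    have hmul : 105 * t ≤ 8568 := by omega
    omega
  rcases (show t ≤ 5 ∨ (6 ≤ t ∧ t ≤ 8) ∨ 9 ≤ t by omega) with ht5 | ⟨ht6, ht8⟩ | ht9
  · have hU := hU5 ht5
    interval_cases t
    · exact cellA _ 31180 232 _ (by norm_num [Nat.choose] at hU; omega) hSkit (by norm_num) (by norm_num) (by norm_num [Nat.choose]) hA
    · exact cellA _ 31180 235 _ (by norm_num [Nat.choose] at hU; omega) hSkit (by norm_num) (by norm_num) (by norm_num [Nat.choose]) hA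
    · exact cellA _ 31180 238 _ (by norm_num [Nat.choose] at hU; omega) hSkit (by norm_num) (by norm_num) (by norm_num [Nat.choose]) hA
    · exact cellA _ 21313 203 _ (by norm_num [Nat.choose] at hU; omega) (hspan3 (by omega)) (by norm_num) (by norm_num) (by norm_num [Nat.choose]) hA
    · exact cellA _ 21313 206 _ (by norm_num [Nat.choose] at hU; omega) (hspan3 (by omega)) (by norm_num) (by norm_num) (by norm_num [Nat.choose]) hA
    · exact cellA _ 21313 209 _ (by norm_num [Nat.choose] at hU; omega) (hspan3 (by omega)) (by norm_num) (by norm_num) (by norm_num [Nat.choose]) hA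
  · exact hrows h4 (by omega) (by omega)
  · have hU := hnine ht9
    rcases (show t = 9 ∨ t = 10 by omega) with ht9e | ht10e
    · subst ht9e
      exact cellA _ 21313 222 _ hU (hspan3 (by omega)) (by norm_num) (by norm_num) (by norm_num [Nat.choose]) hA
    · subst ht10e
      exact cellA _ 21313 225 _ hU (hspan3 (by omega)) (by norm_num) (by norm_num) (by norm_num [Nat.choose]) hA


/-- The tail side of the cell `(12, 6)` on the caps `10 / 36 / 162` with the spanning count `S` a parameter (the kit's rank part `112705514 / 2115`). -/
theorem tail_twelve_six_cfk1_of_spread (S m : ℕ) (h : (1024 : ℚ) * ((112705514 / 2115 : ℚ) + (S : ℚ)) ≤ (m : ℚ) * 2 ^ 18) :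
    1024 * ((((12 + 6).choose 4 : ℚ) +
      (∑ j ∈ Finset.range 6, (Nat.choose (min 5 ((6 + 3) / 2 + 1 - 2)) j : ℚ) / (((j + 1) + 3 * (j + 1).choose 2 + 3 * (j + 1).choose 3 + 2 * (j + 1).choose 4 : ℕ) : ℚ)) *
        ((10 * (12 + 6 - 3).choose 2 + 36 * (12 + 6 - 4) + 162 : ℕ) : ℚ) +
      ((∑ j ∈ Finset.range 6, (Nat.choose 5 j : ℚ) / (((j + 1) + 3 * (j + 1).choose 2 + 3 * (j + 1).choose 3 + 2 * (j + 1).choose 4 : ℕ) : ℚ)) -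
        (∑ j ∈ Finset.range 6, (Nat.choose (min 5 ((6 + 3) / 2 + 1 - 2)) j : ℚ) / (((j + 1) + 3 * (j + 1).choose 2 + 3 * (j + 1).choose 3 + 2 * (j + 1).choose 4 : ℕ) : ℚ))) *
        ((10 : ℕ).choose 5 : ℚ)) +
      (((12 + 6).choose 3 * 2 ^ 3 + (12 + 6).choose 2 * 2 + (12 + 6) + 1 : ℕ) : ℚ) +
      (((12 + 6).choose 5 : ℚ) + (∑ j ∈ Finset.range (6), (Nat.choose (min 13 ((6 + 6) / 2 + 1 - 2)) j : ℚ) / (((j + 1) + 3 * (j + 1).choose 2 + 3 * (j + 1).choose 3 + 2 * (j + 1).choose 4 : ℕ) : ℚ)) * ((10 * (12 + 6 - 3).choose 3 + 36 * (12 + 6 - 4).choose 2 + 162 * (12 + 6 - 5) + (6 + 5).choose 6 : ℕ) : ℚ) +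
        ((∑ j ∈ Finset.range (6), (Nat.choose (min 19 (5 + 6) - 6) j : ℚ) / (((j + 1) + 3 * (j + 1).choose 2 + 3 * (j + 1).choose 3 + 2 * (j + 1).choose 4 : ℕ) : ℚ)) - (∑ j ∈ Finset.range (6), (Nat.choose (min 13 ((6 + 6) / 2 + 1 - 2)) j : ℚ) / (((j + 1) + 3 * (j + 1).choose 2 + 3 * (j + 1).choose 3 + 2 * (j + 1).choose 4 : ℕ) : ℚ))) *
        ((min 19 (5 + 6)).choose 6 : ℚ)) +
      (S : ℚ)) ≤ (m : ℚ) * 2 ^ (12 + 6) := by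
  have hsm : (∑ j ∈ Finset.range (6), (Nat.choose (min 13 ((6 + 6) / 2 + 1 - 2)) j : ℚ) / (((j + 1) + 3 * (j + 1).choose 2 + 3 * (j + 1).choose 3 + 2 * (j + 1).choose 4 : ℕ) : ℚ)) = 12767 / 4230 := by
    norm_num [Finset.sum_range_succ, Nat.choose]
  have hsg : (∑ j ∈ Finset.range (6), (Nat.choose (min 19 (5 + 6) - 6) j : ℚ) / (((j + 1) + 3 * (j + 1).choose 2 + 3 * (j + 1).choose 3 + 2 * (j + 1).choose 4 : ℕ) : ℚ)) = 12767 / 4230 := by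
    norm_num [Finset.sum_range_succ, Nat.choose]
  have hs4m : (∑ j ∈ Finset.range 6, (Nat.choose (min 5 ((6 + 3) / 2 + 1 - 2)) j : ℚ) / (((j + 1) + 3 * (j + 1).choose 2 + 3 * (j + 1).choose 3 + 2 * (j + 1).choose 4 : ℕ) : ℚ)) = 329 / 180 := by
    norm_num [Finset.sum_range_succ, Nat.choose]
  have hs4g : (∑ j ∈ Finset.range 6, (Nat.choose 5 j : ℚ) / (((j + 1) + 3 * (j + 1).choose 2 + 3 * (j + 1).choose 3 + 2 * (j + 1).choose 4 : ℕ) : ℚ)) = 12767 / 4230 := by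
    norm_num [Finset.sum_range_succ, Nat.choose]
  rw [hsm, hsg, hs4m, hs4g]
  norm_num [Nat.choose] at h ⊢
  linarith

/-- **The coloop-free cell `(12, 6)` at `K = 10219` MODULO ITS SPREAD CASE**: the cases `ν = 5, 4` by the concentrated tail (the kit's
`full` count and the spanning count by nullity), the spread case (no nullity-`4` set on `≤ 9` points) the hypothesis `hspread`. -/
theorem c025_twelve_six_cfk1_of_spread (M : Matroid α) [M.Finite]
    (hR : M.eRank = ((12 : ℕ) : ℕ∞)) (hn : M.E.ncard = 12 + 6)
    (hfree : ∀ e ∈ M.E, ∃ A ⊆ M.E \ {e}, e ∉ M.closure A ∧ e ∉ M.closure ((M.E \ {e}) \ A)) (hK : ∀ e, ¬ M.IsColoop e)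
    (hspread : ¬ (∃ W ⊆ M.E, W.ncard ≤ 9 ∧ W.encard = M.eRk W + 4) → ((phiK 13 5 - 2) / 2) * (Matroid.topCount M 12 5 : ℚ) ≤ (Matroid.midCount M 12 5 : ℚ)) :
    ((phiK 13 5 - 2) / 2) * (Matroid.topCount M 12 5 : ℚ) ≤ (Matroid.midCount M 12 5 : ℚ) := by
  classical
  have hd : M.E.encard = M.eRank + ((6 : ℕ) : ℕ∞) := by
    rw [hR, ← M.ground_finite.cast_ncard_eq, hn]
    push_cast
    ring
  obtain ⟨hs3, hs4, hs5⟩ := caps_twelve_six_cf M hd hn hfree hK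
  have full : ∀ (k : ℕ) {W : Set α}, W ⊆ M.E → W.encard = M.eRk W + k →
      Matroid.topCount M 12 5 ≤ ∑ m ∈ Finset.Icc 5 6, ∑ j ∈ Finset.Icc (m + k - 6) m,
        W.ncard.choose j * (12 + 6 - W.ncard).choose (m - j) := by
    intro k W hW hWk
    refine (S2.topCount_le_sum_spanning M hR hd 5).trans ?_
    refine Finset.sum_le_sum (fun m _ => ?_)
    have h := S2.ncard_spanning_compl_le_of_nullity M hW hd hWk (m := m)
    rw [hn] at h
    exact h
  have span : ∀ (k : ℕ) {W : Set α}, W ⊆ M.E → W.encard = M.eRk W + k →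
      {X : Set α | X ⊆ M.E ∧ M.eRk X = M.eRank}.ncard ≤ ∑ m ∈ Finset.range (6 + 1), ∑ j ∈ Finset.Icc (m + k - 6) m,
        W.ncard.choose j * (12 + 6 - W.ncard).choose (m - j) := by
    intro k W hW hWk
    have h := S2.ncard_spanning_le_of_nullity M hW hd hWk
    rw [hn] at h
    exact h
  have cell : ∀ (U S m : ℕ), Matroid.topCount M 12 5 ≤ U → {X : Set α | X ⊆ M.E ∧ M.eRk X = M.eRank}.ncard ≤ S → m ≤ 1024 →
      1024 * (U : ℚ) ≤ ((1024 - m : ℕ) : ℚ) * 2 ^ (6 - 5) * (10219 : ℚ) →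
      (1024 : ℚ) * ((112705514 / 2115 : ℚ) + (S : ℚ)) ≤ (m : ℚ) * 2 ^ 18 → ((phiK 13 5 - 2) / 2) * (Matroid.topCount M 12 5 : ℚ) ≤ (Matroid.midCount M 12 5 : ℚ) := by
    intro U S m hU hS hm hpoly htail
    exact c025_core_five_cell_of_topCount_spanning_xqictq5g M 12 6 (by norm_num) hR hn hfree 10 36 162 hs3 hs4 hs5 U hU S hS
      10219 (by norm_num) (((phiK 13 5 - 2) / 2)) (by rw [phiK_thirteen_five]; norm_num) ⟨m, hm, hpoly, tail_twelve_six_cfk1_of_spread S m htail⟩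
  by_cases h5 : ∃ W ⊆ M.E, W.ncard ≤ 10 ∧ W.encard = M.eRk W + 5
  · obtain ⟨W, hW, hWn, hWk⟩ := h5
    have hU' : Matroid.topCount M 12 5 ≤ 4158 := by
      refine (full 5 hW hWk).trans ?_
      generalize W.ncard = w at hWn ⊢
      interval_cases w <;> decide
    have hS' : {X : Set α | X ⊆ M.E ∧ M.eRk X = M.eRank}.ncard ≤ 5952 := by
      refine (span 5 hW hWk).trans ?_
      generalize W.ncard = w at hWn ⊢
      interval_cases w <;> decide
    exact cell 4158 5952 232 hU' hS' (by norm_num) (by norm_num) (by norm_num)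
  by_cases h4 : ∃ W ⊆ M.E, W.ncard ≤ 9 ∧ W.encard = M.eRk W + 4
  · obtain ⟨W, hW, hWn, hWk⟩ := h4
    have hU' : Matroid.topCount M 12 5 ≤ 10038 := by
      refine (full 4 hW hWk).trans ?_
      generalize W.ncard = w at hWn ⊢
      interval_cases w <;> decide
    have hS' : {X : Set α | X ⊆ M.E ∧ M.eRk X = M.eRank}.ncard ≤ 13120 := by
      refine (span 4 hW hWk).trans ?_
      generalize W.ncard = w at hWn ⊢
      interval_cases w <;> decide
    exact cell 10038 13120 260 hU' hS' (by norm_num) (by norm_num) (by norm_num)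
  · exact hspread h4

/-- **The scaled coloop-free cell `(12, 6)` at `K₁ = 10219` modulo the spread rows `t = 6, 7, 8`.** -/
theorem c025_twelve_six_cfk1_of_rows (M : Matroid α) [M.Finite]
    (hR : M.eRank = ((12 : ℕ) : ℕ∞)) (hn : M.E.ncard = 12 + 6)
    (hfree : ∀ e ∈ M.E, ∃ A ⊆ M.E \ {e}, e ∉ M.closure A ∧ e ∉ M.closure ((M.E \ {e}) \ A)) (hK : ∀ e, ¬ M.IsColoop e)
    (hrows : ¬ (∃ W ⊆ M.E, W.ncard ≤ 9 ∧ W.encard = M.eRk W + 4) →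
      6 ≤ {C : Set α | M.IsCircuit C ∧ C.ncard = 3}.ncard → {C : Set α | M.IsCircuit C ∧ C.ncard = 3}.ncard ≤ 8 →
      ((phiK 13 5 - 2) / 2) * (Matroid.topCount M 12 5 : ℚ) ≤ (Matroid.midCount M 12 5 : ℚ)) :
    ((phiK 13 5 - 2) / 2) * (Matroid.topCount M 12 5 : ℚ) ≤ (Matroid.midCount M 12 5 : ℚ) :=
  c025_twelve_six_cfk1_of_spread M hR hn hfree hK (fun h4 => c025_twelve_six_cfk1_spread_of_rows M hR hn hfree hK h4 hrows)

end ThmN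

end PercRepro
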